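import Literature.NumberTheory.QuadraticForms.HilbertSymbolNormCompat
import Literature.NumberTheory.QuadraticForms.HilbertSymbolNormCompatAtTwoCompletion
import Literature.NumberTheory.LocalFields.PadicFieldIsCompletionOfNumberField
import HarnessLib

/-!
# The projection formula `(a, b)_K = (a, N_{K/ℚ₂} b)_{ℚ₂}` for an ABSTRACT finite extension `K/ℚ₂`
# — discharge of the named fact `HilbertSymbolNormCompatAtTwo` modulo «`K` is a completion of a number field»

Topic `NumberTheory/QuadraticForms`; namespace `Literature.NumberTheory.QuadraticForms`; a *proofs* file
(theorems only, nothing re-declared).  Cell `hodgecm-mathlib`, background item (O-NC), zero `HC_CM` currency: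
a generic gift that, composed with `hilbertSymbol_normCompat_adicCompletion_two`
(`HilbertSymbolNormCompatAtTwoCompletion.lean`, the global road through Hilbert reciprocity, no local class field
theory), lets the cell `bsd-f1-sign2` discharge its vendored named fact `HilbertSymbolNormCompatAtTwo`
(`HilbertSymbolNormCompat.lean`: Neukirch IV (6.4) with V (3.1)–(3.2)).

The only input beyond the completion-currency theorem is the structure fact «every finite extension `K` of
`ℚ_p` is `ℚ_p`-isomorphic to the completion `F_𝔭` of a number field `F` at a place `𝔭 ∣ p`, `F_𝔭` carrying its
canonical `ℚ_p`-algebra structure `LocalField.adicCompletionPadicAlgebra`» (Krasner's lemma + density of `ℚ`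
in `ℚ_p`), supplied with its printed locator by
`Literature/NumberTheory/LocalFields/PadicFieldIsCompletionOfNumberField.lean`; here it enters §2 as an
explicit hypothesis (so that §1–§2 do not depend on that file) and §3 instantiates it.

* §1 `hilbertSymbol_normCompat_of_algEquiv_adicCompletion` — transport of the completion-currency formula
  along a `ℚ₂`-algebra isomorphism `φ : K ≃ₐ[ℚ₂] F_𝔭` (`hilbertSymbol_map_ringEquiv`, `AlgEquiv.commutes`,
  `Algebra.norm_eq_of_algEquiv`);
* §2 `hilbertSymbolNormCompatAtTwo_of_completionModel` — the named fact from the structure fact at `p = 2`;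
* §3 `hilbertSymbolNormCompatAtTwo_holds : HilbertSymbolNormCompatAtTwo` — the DISCHARGE, §2 applied to
  `Literature.NumberTheory.LocalFields.exists_numberField_algEquiv_adicCompletion 2`.

## References
* [NeukirchANT1999] J. Neukirch, *Algebraic Number Theory* (1999), Ch. IV (6.4), Ch. V (3.1)–(3.2) (the
  statement); Ch. VI (5.7) (the global proof of the local norm functoriality).
* [Omeara1963] O. T. O'Meara, *Introduction to quadratic forms* (1963), §63B, §71 Thm. 71:18.
-/

noncomputable section

open scoped Classical
open NumberField IsDedekindDomain IsDedekindDomain.HeightOneSpectrum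
open Literature.NumberTheory.GaloisRepresentations (LocalField.adicCompletionPadicAlgebra)

namespace Literature.NumberTheory.QuadraticForms

/-! ### §1 Transport along a `ℚ₂`-algebra isomorphism with a completion -/

/-- **Transport of the projection formula along a `ℚ₂`-isomorphism with a dyadic completion.**  If the finite
extension `K/ℚ₂` is `ℚ₂`-isomorphic to the completion `F_𝔭` (`𝔭 ∣ 2`) of a number field `F` — `F_𝔭` a
`ℚ₂`-algebra through `LocalField.adicCompletionPadicAlgebra 𝔭 2 h2` — then for `a ∈ ℚ₂ˣ`, `b ∈ Kˣ`:
`(a, b)_K = (a, N_{K/ℚ₂} b)_{ℚ₂}`.  The O'Meara symbol is invariant under ring isomorphisms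
(`hilbertSymbol_map_ringEquiv`), `φ` fixes `ℚ₂` and preserves `N_{·/ℚ₂}` (`Algebra.norm_eq_of_algEquiv`), and
the formula holds for `F_𝔭` (`hilbertSymbol_normCompat_adicCompletion_two`).
[cite: NeukirchANT1999, Ch. IV (6.4) and Ch. V (3.1)–(3.2)] [cite: Omeara1963, §71 Thm. 71:18] -/
theorem hilbertSymbol_normCompat_of_algEquiv_adicCompletion
    {K : Type*} [Field K] [Algebra ℚ_[2] K]
    (F : Type) [Field F] [NumberField F] (𝔭 : HeightOneSpectrum (𝓞 F)) (h2 : ((2 : ℕ) : 𝓞 F) ∈ 𝔭.asIdeal)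
    (φ : letI := LocalField.adicCompletionPadicAlgebra 𝔭 2 h2; K ≃ₐ[ℚ_[2]] 𝔭.adicCompletion F)
    {a : ℚ_[2]} (ha : a ≠ 0) {b : K} (hb : b ≠ 0) :
    hilbertSymbol K (algebraMap ℚ_[2] K a) b = hilbertSymbol ℚ_[2] a (Algebra.norm ℚ_[2] b) := by
  letI := LocalField.adicCompletionPadicAlgebra 𝔭 2 h2
  rw [← hilbertSymbol_map_ringEquiv φ.toRingEquiv (algebraMap ℚ_[2] K a) b]
  change hilbertSymbol (𝔭.adicCompletion F) (φ (algebraMap ℚ_[2] K a)) (φ b) = _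
  rw [φ.commutes a, ← Algebra.norm_eq_of_algEquiv φ b]
  exact hilbertSymbol_normCompat_adicCompletion_two F 𝔭 h2 ha ((map_ne_zero φ).2 hb)

/-! ### §2 The named fact from the structure fact «`K/ℚ₂` finite is a completion of a number field» -/

/-- **`HilbertSymbolNormCompatAtTwo` from the completion model.**  If every finite extension `K` of `ℚ₂` is
`ℚ₂`-isomorphic to a dyadic completion `F_𝔭` of some number field `F` (with its canonical `ℚ₂`-algebra
structure `LocalField.adicCompletionPadicAlgebra 𝔭 2 h2`) — Krasner's lemma with the density of `ℚ` in `ℚ₂`,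
`Literature/NumberTheory/LocalFields/PadicFieldIsCompletionOfNumberField.lean` — then the projection formula
`(a, b)_K = (a, N_{K/ℚ₂} b)_{ℚ₂}` holds for every such `K`, i.e. the named fact `HilbertSymbolNormCompatAtTwo`
(Neukirch IV (6.4) with V (3.1)–(3.2)) holds, by §1 and the completion-currency theorem
`hilbertSymbol_normCompat_adicCompletion_two` (global road, Hilbert reciprocity).
[cite: NeukirchANT1999, Ch. IV (6.4) and Ch. V (3.1)–(3.2)] [cite: Omeara1963, §71 Thm. 71:18] -/
theorem hilbertSymbolNormCompatAtTwo_of_completionModel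
    (h : ∀ (K : Type) [Field K] [Algebra ℚ_[2] K] [FiniteDimensional ℚ_[2] K],
      ∃ (F : Type) (_ : Field F) (_ : NumberField F) (𝔭 : HeightOneSpectrum (𝓞 F))
        (h𝔭 : ((2 : ℕ) : 𝓞 F) ∈ 𝔭.asIdeal),
        Nonempty (letI := LocalField.adicCompletionPadicAlgebra 𝔭 2 h𝔭; K ≃ₐ[ℚ_[2]] 𝔭.adicCompletion F)) :
    HilbertSymbolNormCompatAtTwo := by
  intro K _ _ _ a b ha hb
  obtain ⟨F, _, _, 𝔭, h𝔭, ⟨φ⟩⟩ := h K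
  exact hilbertSymbol_normCompat_of_algEquiv_adicCompletion F 𝔭 h𝔭 φ ha hb

/-! ### §3 The discharge -/

/-- **The projection (norm-compatibility) formula for the quadratic Hilbert symbol over `ℚ₂` HOLDS**: for
every finite extension `K/ℚ₂`, `a ∈ ℚ₂ˣ`, `b ∈ Kˣ`, `(a, b)_K = (a, N_{K/ℚ₂} b)_{ℚ₂}` — the named fact
`HilbertSymbolNormCompatAtTwo` (Neukirch IV (6.4) with V (3.1)–(3.2), `HilbertSymbolNormCompat.lean`) is a
THEOREM of the tree: every such `K` is `ℚ₂`-isomorphic to a dyadic completion `F_𝔭` of a number field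
(`Literature.NumberTheory.LocalFields.exists_numberField_algEquiv_adicCompletion`, Krasner's lemma with the
density of `ℚ` in `ℚ₂`), for which the formula is `hilbertSymbol_normCompat_adicCompletion_two` (the global
road: Hilbert reciprocity over `F` and over `ℚ`, the odd-place norm identity, weak approximation of local
square classes, the norm packet (19.19)); transport §1–§2.  No local class field theory is used.
[cite: NeukirchANT1999, Ch. IV (6.4) and Ch. V (3.1)–(3.2); Ch. VI (5.7)] [cite: Omeara1963, §71 Thm. 71:18] -/
theorem hilbertSymbolNormCompatAtTwo_holds : HilbertSymbolNormCompatAtTwo :=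
  hilbertSymbolNormCompatAtTwo_of_completionModel fun K _ _ _ =>
    Literature.NumberTheory.LocalFields.exists_numberField_algEquiv_adicCompletion 2 K

end Literature.NumberTheory.QuadraticForms

end
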